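import Literature.GroupTheory.CombinatorialGroupTheory.FreeGroupCentralizers
import Mathlib.GroupTheory.SpecificGroups.Cyclic
import HarnessLib

/-!
# Commuting powers in free groups; nonabelian free groups (`IsFreeGroup` forms)

Three classical facts about free groups, stated for an abstract free group `G` (`IsFreeGroup G`, any
rank) and derived from the cyclicity of centralizers in `FreeGroup α`
(`FreeGroupCentralizers.lean`, Lyndon–Schupp Ch. I Prop. 2.17 ff.) [cite: LyndonSchupp2001, Ch. I Prop. 2.17]:

* `exists_generators_ne` — a nonabelian free group has two distinct free generators;
* `commute_of_commute_pow` — if `a ^ m` (`m ≠ 0`) commutes with `c` then `a` commutes with `c`;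
* `exists_not_commute_of_finiteIndex_of_isFreeGroup` — a finite-index subgroup of a nonabelian free
  group is nonabelian.

(Equivalent forms of the last two for the [EtTh] Lemma 2.17 discharge live in
`EtaleTheta/Discharge/Sec2DiscreteNormalizersTemperedFI.lean`, abc-iut-L2-d3; recorded here Mathlib-side
for the pro-`Σ` slimness files of `AnabelianGeometry/SemiGraphs/`.)  Theorems only.
-/

namespace Literature.GroupTheory.CombinatorialGroupTheory

/-- A nonabelian free group has two distinct free generators (a free group on at most one generator
is cyclic, hence abelian). [cite: LyndonSchupp2001, Ch. I Prop. 2.17] -/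
theorem exists_generators_ne {G : Type*} [Group G] [IsFreeGroup G] (h : ∃ x y : G, x * y ≠ y * x) :
    ∃ a b : IsFreeGroup.Generators G, a ≠ b := by
  by_contra hall
  push Not at hall
  obtain ⟨x, y, hxy⟩ := h
  apply hxy
  let e := IsFreeGroup.toFreeGroup G
  rcases isEmpty_or_nonempty (IsFreeGroup.Generators G) with hE | ⟨⟨a₀⟩⟩
  · apply e.injective
    exact Subsingleton.elim _ _
  · haveI : Unique (IsFreeGroup.Generators G) := ⟨⟨a₀⟩, fun a => hall a a₀⟩
    obtain ⟨g, hg⟩ := IsCyclic.exists_generator (α := FreeGroup (IsFreeGroup.Generators G))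
    obtain ⟨i, hi⟩ := Subgroup.mem_zpowers_iff.mp (hg (e x))
    obtain ⟨j, hj⟩ := Subgroup.mem_zpowers_iff.mp (hg (e y))
    apply e.injective
    rw [map_mul, map_mul, ← hi, ← hj]
    exact ((Commute.refl g).zpow_zpow i j).eq

/-- In a free group, if `a ^ m` commutes with `c` for some `m ≠ 0`, then `a` commutes with `c`
(centralizers of nontrivial elements of free groups are cyclic, tree `FreeGroup.exists_centralizer_eq_zpowers`).
[cite: LyndonSchupp2001, Ch. I Prop. 2.17] -/
theorem commute_of_commute_pow {G : Type*} [Group G] [IsFreeGroup G] {a c : G} {m : ℕ} (hm : m ≠ 0)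
    (h : Commute (a ^ m) c) : Commute a c := by
  by_cases ha : a = 1
  · rw [ha]; exact Commute.one_left c
  let e := IsFreeGroup.toFreeGroup G
  have hx : e a ≠ 1 := fun h1 => ha (e.injective (h1.trans (map_one e).symm))
  have hxm : (e a) ^ m ≠ 1 := fun h1 => hx ((pow_eq_one_iff_left hm).mp h1)
  obtain ⟨t, ht⟩ := FreeGroup.exists_centralizer_eq_zpowers hxm
  have hxin : e a ∈ Subgroup.centralizer {(e a) ^ m} :=
    Subgroup.mem_centralizer_singleton_iff.mpr (Commute.self_pow (e a) m).eq
  have huin : e c ∈ Subgroup.centralizer {(e a) ^ m} := by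
    refine Subgroup.mem_centralizer_singleton_iff.mpr ?_
    have := (h.map e).symm.eq
    rwa [map_pow] at this
  rw [ht] at hxin huin
  obtain ⟨i, hi⟩ := Subgroup.mem_zpowers_iff.mp hxin
  obtain ⟨j, hj⟩ := Subgroup.mem_zpowers_iff.mp huin
  have hc : Commute (e a) (e c) := by
    rw [← hi, ← hj]
    exact (Commute.refl t).zpow_zpow i j
  have := hc.map e.symm
  simpa using this

/-- A finite-index subgroup of a nonabelian free group is nonabelian (suitable powers of two
non-commuting elements lie in it and still do not commute).
[cite: LyndonSchupp2001, Ch. I Prop. 2.17] -/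
theorem exists_not_commute_of_finiteIndex_of_isFreeGroup {G : Type*} [Group G] [IsFreeGroup G]
    {a b : G} (hab : a * b ≠ b * a) (K : Subgroup G) [K.FiniteIndex] :
    ∃ x ∈ K, ∃ y ∈ K, x * y ≠ y * x := by
  have hm : K.normalCore.index ≠ 0 := Subgroup.FiniteIndex.index_ne_zero
  refine ⟨a ^ K.normalCore.index, K.normalCore_le (K.normalCore.pow_index_mem a),
    b ^ K.normalCore.index, K.normalCore_le (K.normalCore.pow_index_mem b), fun h => hab ?_⟩
  have h1 : Commute (a ^ K.normalCore.index) (b ^ K.normalCore.index) := h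
  have h2 : Commute a (b ^ K.normalCore.index) := commute_of_commute_pow hm h1
  have h3 : Commute b a := commute_of_commute_pow hm h2.symm
  exact h3.symm.eq

end Literature.GroupTheory.CombinatorialGroupTheory
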